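import Literature.RingTheory.Flat.IdealDescent
import Literature.RingTheory.Flat.FiberRegularElement
import HarnessLib

/-!
# Descent of `𝔪'`-primary ideals along a flat local algebra: the descent datum need only hold modulo fibre-regular elements

Helper for `stub_keyRungGrHomLE_three` of `HypersurfaceCentreConstruction` (stmt-ResolutionOfSingularities-19897),
hypothesis (IDLexact)₃ of the gap list of record `keyRungGrHomLE_three_of_idealDescentExact4` (p820504): «the two
levels of an exactly ratio-maximal two-flag upstairs are EXTENDED from downstairs».  [OURS · descent engine, pure
commutative algebra; AI work, weaker than expert review.]

THE ENGINE.  Let `T → T'` be a ring map with `T'` local and flat over `T`, `C := T' ⊗_T T'` with its two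
coprojections `p₁ = includeLeft`, `p₂ = includeRight`, and `I ⊆ T'` an ideal of finite colength (`T'/I` of finite
length, e.g. `𝔪'`-primary in a Noetherian `T'`).  By fpqc descent (flat half, `Literature.RingTheory.Flat.IdealDescent`)
`I` is extended from `T` as soon as `p₁(I)C ≤ p₂(I)C`.  We prove that it suffices to check this datum UP TO ELEMENTS
REGULAR ON THE FIBRE `C/p₁(𝔪')C`: if for every `x ∈ I` some `s ∈ C`, a non-zero-divisor modulo `p₁(𝔪')C`, has
`s·(1 ⊗ x) ∈ p₁(I)C`, then `I = (I ∩ T)·T'` (`eq_map_comap_of_fibreRegular`).  The point: by Bruns–Herzog 1.2.17 (b)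
(`Literature.RingTheory.Flat.FiberRegularElement.isSMulRegular_tensor_of_isFiniteLength`, with `N = C` flat over
`R = T'` via `p₁` and `X = T'/I` of finite length) such an `s` is a non-zero-divisor on `C ⊗_{T'} T'/I = C/p₁(I)C`.
Packaged with prime avoidance (`eq_map_comap_of_minimalPrimes`): if the fibre ideal `p₁(𝔪')C` is radical with finitely
many minimal primes `𝔓`, it suffices that `p₂(I)C_𝔓 ≤ p₁(I)C_𝔓` in the sense `∃ s ∉ 𝔓, s·(1 ⊗ x) ∈ p₁(I)C` for each
`x ∈ I` and each such `𝔓` — i.e. the datum is checked at the GENERIC POINTS OF THE FIBRE only.  In the door setting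
(`T → T'` local formally smooth e.f.t. of regular local rings with `𝔪T' = 𝔪'`, separable residue extension) these generic
points `C_𝔓` are again regular local of the same dimension with `𝔪C_𝔓` maximal, so (IDLexact)₃ reduces to the
INVARIANCE of the two levels along the two maps `T' ⇉ C_𝔓` inside the class (memo SIGMA-EXT-DESCENT §3); that class-level
specialisation is not in this file.

References: The Stacks Project, Tags 023N/0245 (fpqc descent of closed subschemes); W. Bruns, J. Herzog,
*Cohen–Macaulay rings*, Lemma 1.2.17 (b); H. Matsumura, *Commutative Ring Theory*, Cor. to Thm. 22.5.
-/

noncomputable section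

open IsLocalRing TensorProduct Algebra.TensorProduct

set_option linter.dupNamespace false -- mandated namespace of this single-conjunct summit

namespace Summit.ResolutionOfSingularities.ResolutionOfSingularities.Cruxes.HypersurfaceCentreConstruction.LocalEngine

namespace FibreDescent

universe u v

variable {T : Type u} {T' : Type v} [CommRing T] [CommRing T'] [Algebra T T']

/-- The extension of an ideal of `T'` along `includeLeft : T' → T' ⊗_T T'` is its extension along the structure map of
the (left) `T'`-algebra `T' ⊗_T T'`. [folklore] -/
theorem map_includeLeft_eq_map_algebraMap (I : Ideal T') :
    I.map (includeLeft : T' →ₐ[T] T' ⊗[T] T') = I.map (algebraMap T' (T' ⊗[T] T')) := by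
  unfold Ideal.map
  congr 1

/-- A non-zero-divisor modulo an ideal `J` of a ring `C`, elementwise (`s·c ∈ J ⇒ c ∈ J`), is `IsSMulRegular` on the
quotient module `C ⧸ J•⊤`. [folklore] -/
theorem isSMulRegular_quotient_smul_top_of_forall {C : Type*} [CommRing C] (J : Ideal C) (s : C)
    (hs : ∀ c : C, s * c ∈ J → c ∈ J) :
    IsSMulRegular (C ⧸ (J • ⊤ : Submodule C C)) s := by
  have hJ : (J • ⊤ : Submodule C C) = J := by rw [Ideal.smul_eq_mul, Ideal.mul_top]
  refine (isSMulRegular_iff_right_eq_zero_of_smul (M := C ⧸ (J • ⊤ : Submodule C C)) (r := s)).mpr fun m hm => ?_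
  obtain ⟨c, rfl⟩ := Submodule.Quotient.mk_surjective _ m
  rw [← Submodule.Quotient.mk_smul, Submodule.Quotient.mk_eq_zero, hJ, smul_eq_mul] at hm
  rw [Submodule.Quotient.mk_eq_zero, hJ]
  exact hs c hm

/-- **Fibre-regular elements are regular modulo `p₁(I)C`.**  If `T'` is local, `T' ⊗_T T'` is flat over `T'` (e.g. `T'`
flat over `T`), `T'/I` has finite length and `s ∈ C = T' ⊗_T T'` is a non-zero-divisor modulo the fibre ideal
`p₁(𝔪')C`, then `s` is a non-zero-divisor modulo `p₁(I)C` (Bruns–Herzog 1.2.17 (b) with `N = C`, `X = T'/I`, and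
`C ⊗_{T'} T'/I ≅ C/p₁(I)C`). [cite: BrunsHerzog1998, §1.2 Lemma 1.2.17 (b)] -/
theorem regular_mod_map_of_regular_mod_fibre [IsLocalRing T'] [Module.Flat T' (T' ⊗[T] T')] (I : Ideal T')
    (hI : IsFiniteLength T' (T' ⧸ I)) {s : T' ⊗[T] T'}
    (hs : ∀ c : T' ⊗[T] T', s * c ∈ (maximalIdeal T').map (algebraMap T' (T' ⊗[T] T')) →
      c ∈ (maximalIdeal T').map (algebraMap T' (T' ⊗[T] T')))
    (c : T' ⊗[T] T') (hc : s * c ∈ I.map (algebraMap T' (T' ⊗[T] T'))) :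
    c ∈ I.map (algebraMap T' (T' ⊗[T] T')) := by
  have hy : IsSMulRegular ((T' ⊗[T] T') ⧸ ((maximalIdeal T').map (algebraMap T' (T' ⊗[T] T')) • ⊤ :
      Submodule (T' ⊗[T] T') (T' ⊗[T] T'))) s :=
    isSMulRegular_quotient_smul_top_of_forall _ s hs
  have hreg : IsSMulRegular ((T' ⊗[T] T') ⊗[T'] (T' ⧸ I)) s :=
    Literature.RingTheory.Flat.isSMulRegular_tensor_of_isFiniteLength (R := T') (S := T' ⊗[T] T')
      (N := T' ⊗[T] T') hy hI
  set J : Ideal (T' ⊗[T] T') := I.map (algebraMap T' (T' ⊗[T] T')) with hJ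
  let e := Algebra.TensorProduct.quotIdealMapEquivTensorQuot (T' ⊗[T] T') I
  have h1 : e (Ideal.Quotient.mk J (s * c)) = s • (c ⊗ₜ[T'] (1 : T' ⧸ I)) := by
    rw [Algebra.TensorProduct.quotIdealMapEquivTensorQuot_mk, TensorProduct.smul_tmul', smul_eq_mul]
  have h0 : Ideal.Quotient.mk J (s * c) = 0 := Ideal.Quotient.eq_zero_iff_mem.mpr hc
  have h2 : s • (c ⊗ₜ[T'] (1 : T' ⧸ I)) = 0 := by rw [← h1, h0, map_zero]
  have h3 : c ⊗ₜ[T'] (1 : T' ⧸ I) = 0 := hreg.right_eq_zero_of_smul h2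
  have h4 : e (Ideal.Quotient.mk J c) = 0 := by
    rw [Algebra.TensorProduct.quotIdealMapEquivTensorQuot_mk, h3]
  have h5 : Ideal.Quotient.mk J c = 0 := by
    rwa [map_eq_zero_iff e e.injective] at h4
  exact Ideal.Quotient.eq_zero_iff_mem.mp h5

/-- **The descent datum modulo fibre-regular elements, `p₂ ≤ p₁` form.**  `T'` local, `T' ⊗_T T'` flat over `T'`, `T'/I`
of finite length; if every `x ∈ I` admits a non-zero-divisor `s` modulo `p₁(𝔪')C` with `s·(1 ⊗ x) ∈ p₁(I)C`, then
`p₂(I)C ≤ p₁(I)C`. [folklore] -/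
theorem map_includeRight_le_map_includeLeft_of_fibreRegular [IsLocalRing T'] [Module.Flat T' (T' ⊗[T] T')]
    (I : Ideal T') (hI : IsFiniteLength T' (T' ⧸ I))
    (H : ∀ x ∈ I, ∃ s : T' ⊗[T] T',
      (∀ c : T' ⊗[T] T', s * c ∈ (maximalIdeal T').map (algebraMap T' (T' ⊗[T] T')) →
        c ∈ (maximalIdeal T').map (algebraMap T' (T' ⊗[T] T'))) ∧
      s * ((1 : T') ⊗ₜ[T] x) ∈ I.map (algebraMap T' (T' ⊗[T] T'))) :
    I.map (includeRight : T' →ₐ[T] T' ⊗[T] T') ≤ I.map (includeLeft : T' →ₐ[T] T' ⊗[T] T') := by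
  rw [map_includeLeft_eq_map_algebraMap, Ideal.map_le_iff_le_comap]
  intro x hx
  obtain ⟨s, hs, hsx⟩ := H x hx
  rw [Ideal.mem_comap]
  exact regular_mod_map_of_regular_mod_fibre I hI hs _ hsx

/-- The flip `σ : T' ⊗_T T' ≃ T' ⊗_T T'` is an involution. [folklore] -/
theorem comm_comm_apply (y : T' ⊗[T] T') :
    Algebra.TensorProduct.comm T T' T' (Algebra.TensorProduct.comm T T' T' y) = y := by
  induction y using TensorProduct.induction_on with
  | zero => simp only [map_zero]
  | tmul a b => rw [Algebra.TensorProduct.comm_tmul, Algebra.TensorProduct.comm_tmul]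
  | add a b ha hb => rw [map_add, map_add, ha, hb]

/-- The flip carries `p₁(I)C` into `p₂(I)C`. [folklore] -/
theorem comm_mem_map_includeRight_of_mem_map_includeLeft (I : Ideal T') {y : T' ⊗[T] T'}
    (hy : y ∈ I.map (includeLeft : T' →ₐ[T] T' ⊗[T] T')) :
    Algebra.TensorProduct.comm T T' T' y ∈ I.map (includeRight : T' →ₐ[T] T' ⊗[T] T') := by
  have hle : I.map (includeLeft : T' →ₐ[T] T' ⊗[T] T') ≤
      (I.map (includeRight : T' →ₐ[T] T' ⊗[T] T')).comap
        (Algebra.TensorProduct.comm T T' T').toAlgHom.toRingHom := by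
    rw [Ideal.map_le_iff_le_comap]
    intro x hx
    rw [Ideal.mem_comap, Ideal.mem_comap]
    change Algebra.TensorProduct.comm T T' T' (x ⊗ₜ[T] 1) ∈ _
    rw [Algebra.TensorProduct.comm_tmul]
    exact Ideal.mem_map_of_mem (includeRight : T' →ₐ[T] T' ⊗[T] T') hx
  exact hle hy

/-- Transport of the `p₂ ≤ p₁` datum to the `p₁ ≤ p₂` datum by the flip `T' ⊗_T T' ≃ T' ⊗_T T'`. [folklore] -/
theorem map_includeLeft_le_map_includeRight_of_flip (I : Ideal T')
    (h : I.map (includeRight : T' →ₐ[T] T' ⊗[T] T') ≤ I.map (includeLeft : T' →ₐ[T] T' ⊗[T] T')) :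
    I.map (includeLeft : T' →ₐ[T] T' ⊗[T] T') ≤ I.map (includeRight : T' →ₐ[T] T' ⊗[T] T') := by
  intro y hy
  have h1 := comm_mem_map_includeRight_of_mem_map_includeLeft I hy
  have h2 := comm_mem_map_includeRight_of_mem_map_includeLeft I (h h1)
  rwa [comm_comm_apply] at h2

/-- **DESCENT ENGINE.**  Let `T'` be a local algebra, flat over `T`, and `I ⊆ T'` an ideal with `T'/I` of finite length.
If every `x ∈ I` admits an element `s ∈ T' ⊗_T T'`, a non-zero-divisor modulo the fibre ideal `p₁(𝔪')·(T' ⊗_T T')`, with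
`s·(1 ⊗ x) ∈ p₁(I)·(T' ⊗_T T')`, then `I` is extended from `T`: `I = (I ∩ T)·T'`.
[cite: StacksProject, Tag 0245] [cite: BrunsHerzog1998, §1.2 Lemma 1.2.17 (b)] -/
theorem eq_map_comap_of_fibreRegular [IsLocalRing T'] [Module.Flat T T'] (I : Ideal T')
    (hI : IsFiniteLength T' (T' ⧸ I))
    (H : ∀ x ∈ I, ∃ s : T' ⊗[T] T',
      (∀ c : T' ⊗[T] T', s * c ∈ (maximalIdeal T').map (algebraMap T' (T' ⊗[T] T')) →
        c ∈ (maximalIdeal T').map (algebraMap T' (T' ⊗[T] T'))) ∧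
      s * ((1 : T') ⊗ₜ[T] x) ∈ I.map (algebraMap T' (T' ⊗[T] T'))) :
    I = (I.comap (algebraMap T T')).map (algebraMap T T') :=
  Literature.RingTheory.Flat.Ideal.eq_map_comap_of_map_includeLeft_le I
    (map_includeLeft_le_map_includeRight_of_flip I (map_includeRight_le_map_includeLeft_of_fibreRegular I hI H))

/-- Outside every minimal prime of a RADICAL ideal `F` an element is a non-zero-divisor modulo `F`
(`F = ⋂` of its minimal primes). [folklore] -/
theorem regular_mod_of_forall_not_mem_minimalPrimes {C : Type*} [CommRing C] {F : Ideal C} (hF : F.IsRadical)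
    {s : C} (hs : ∀ 𝔓 ∈ F.minimalPrimes, s ∉ 𝔓) (c : C) (hc : s * c ∈ F) : c ∈ F := by
  rw [← hF.radical, ← Ideal.sInf_minimalPrimes, Submodule.mem_sInf]
  intro 𝔓 h𝔓
  have hprime : Ideal.IsPrime 𝔓 := h𝔓.1.1
  have hle : F ≤ 𝔓 := h𝔓.1.2
  rcases hprime.mem_or_mem (hle hc) with h | h
  · exact absurd h (hs 𝔓 h𝔓)
  · exact h

/-- Prime avoidance for a finite family of primes: an ideal contained in none of them has an element outside all of
them. [folklore] -/
theorem exists_mem_forall_not_mem_of_finite {C : Type*} [CommRing C] (K : Ideal C) {P : Set (Ideal C)}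
    (hP : P.Finite) (hprime : ∀ 𝔓 ∈ P, 𝔓.IsPrime) (hK : ∀ 𝔓 ∈ P, ¬ K ≤ 𝔓) :
    ∃ s ∈ K, ∀ 𝔓 ∈ P, s ∉ 𝔓 := by
  classical
  by_contra hcon
  have hsub : (K : Set C) ⊆ ⋃ 𝔓 ∈ (↑hP.toFinset : Set (Ideal C)), ((𝔓 : Ideal C) : Set C) := by
    intro s hs
    by_contra hs'
    refine hcon ⟨s, hs, fun 𝔓 h𝔓 hs𝔓 => hs' ?_⟩
    exact Set.mem_biUnion (Finset.mem_coe.mpr (hP.mem_toFinset.mpr h𝔓)) hs𝔓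
  obtain ⟨𝔓, h𝔓, hle⟩ := (Ideal.subset_union_prime (⊤ : Ideal C) (⊤ : Ideal C)
    (fun 𝔓 h𝔓 _ _ => hprime 𝔓 (hP.mem_toFinset.mp h𝔓))).mp hsub
  exact hK 𝔓 (hP.mem_toFinset.mp h𝔓) hle

/-- **DESCENT AT THE GENERIC POINTS OF THE FIBRE.**  `T'` local and flat over `T`, `T'/I` of finite length; suppose the
fibre ideal `F = p₁(𝔪')·(T' ⊗_T T')` is radical with finitely many minimal primes (e.g. a reduced Noetherian fibre
`κ(T') ⊗_T T'`).  If for every `x ∈ I` and every minimal prime `𝔓` of `F` some `s ∉ 𝔓` has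
`s·(1 ⊗ x) ∈ p₁(I)·(T' ⊗_T T')` (that is, `p₂(I)C_𝔓 ≤ p₁(I)C_𝔓` at each generic point `𝔓` of the fibre), then
`I = (I ∩ T)·T'`. [cite: StacksProject, Tag 0245] [cite: BrunsHerzog1998, §1.2 Lemma 1.2.17 (b)] -/
theorem eq_map_comap_of_minimalPrimes [IsLocalRing T'] [Module.Flat T T'] (I : Ideal T')
    (hI : IsFiniteLength T' (T' ⧸ I))
    (hrad : ((maximalIdeal T').map (algebraMap T' (T' ⊗[T] T'))).IsRadical)
    (hfin : ((maximalIdeal T').map (algebraMap T' (T' ⊗[T] T'))).minimalPrimes.Finite)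
    (H : ∀ x ∈ I, ∀ 𝔓 ∈ ((maximalIdeal T').map (algebraMap T' (T' ⊗[T] T'))).minimalPrimes,
      ∃ s ∉ 𝔓, s * ((1 : T') ⊗ₜ[T] x) ∈ I.map (algebraMap T' (T' ⊗[T] T'))) :
    I = (I.comap (algebraMap T T')).map (algebraMap T T') := by
  refine eq_map_comap_of_fibreRegular I hI fun x hx => ?_
  have hK𝔓 : ∀ 𝔓 ∈ ((maximalIdeal T').map (algebraMap T' (T' ⊗[T] T'))).minimalPrimes,
      ¬ (I.map (algebraMap T' (T' ⊗[T] T'))).colon {(1 : T') ⊗ₜ[T] x} ≤ 𝔓 := by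
    intro 𝔓 h𝔓 hle
    obtain ⟨s, hs𝔓, hs⟩ := H x hx 𝔓 h𝔓
    refine hs𝔓 (hle (Submodule.mem_colon_singleton.mpr ?_))
    change s * ((1 : T') ⊗ₜ[T] x) ∈ _
    exact hs
  obtain ⟨s, hsK, hs⟩ := exists_mem_forall_not_mem_of_finite _ hfin (fun 𝔓 h𝔓 => h𝔓.1.1) hK𝔓
  refine ⟨s, regular_mod_of_forall_not_mem_minimalPrimes hrad hs, ?_⟩
  have h1 := Submodule.mem_colon_singleton.mp hsK
  change s * ((1 : T') ⊗ₜ[T] x) ∈ _ at h1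
  exact h1

end FibreDescent

end Summit.ResolutionOfSingularities.ResolutionOfSingularities.Cruxes.HypersurfaceCentreConstruction.LocalEngine

end
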